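import Literature.Computability.Complexity.ZIntBricks
import Literature.Computability.Complexity.PlumbingBricks

/-!
# Crux `ArithStatLadder.IqThreeNotPPoly` (stmt-QuantumAdvantage-2422)

Stub `stub_samplerAP` of the line `Sketch` (SQUAREFREE-FILTER DOMINATION, skeleton v2): the sampler
of the ONE-parameter planted family is a polynomial-time string function.

On an input pair `⟨x, r⟩` (numeral `x`, `N = ⟦x⟧ = bitsToNat x`, and seed `r`, `k = ⟦r⟧`) it
outputs the canonical numeral of `d = N · t · (27 · N · t − 4)` with `t = 1 + 2 · N · k` — this `d`
is `|Disc|` of the binary cubic form `X³ − X² Y + N t Y³`.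

The witness is an explicit composition of the tree's `FP` bricks (no machine is written):
* `N` and `k` are the values of `fstF`, `sndF` (`fstF_boolPair`, `sndF_boolPair`), lifted to the
  difference-pair integer code of `ZIntBricks.lean` (`exists_ival_nat`);
* `t` and the integer `(N : ℤ) * t * (27 * N * t - 4)` by `zmulF`, `zaddF`, `zsubF`, `zcanonF`
  (values tracked through `Brick.ival`; `exists_arithAP`);
* the absolute value as `addFn` of the two canonical components (`bitsToNat_cP_add_cQ`), and the
  integer closed form agrees with the truncated natural one (`natAbs_closedForm`: for `N ≥ 1`,
  `27 N t ≥ 27 > 4`; for `N = 0` both sides vanish).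
Membership in `FP` is by the closure lemmas `comp_mem_FP`, `fanoutFn_mem_FP`, `const_mem_FP`; the
closed form holds on every input (all functions are total).
-/

noncomputable section

set_option linter.dupNamespace false -- D-0017: single-problem summit ⇒ `QuantumAdvantage.QuantumAdvantage` by design

namespace Summit.QuantumAdvantage.QuantumAdvantage.Theorems.IqThreeNotPPoly

open scoped Classical
open _root_.Computability Literature.Computability.Complexity
open Literature.Computability.Complexity.Brick

/-! ### Integer-valued `FP` expressions (values tracked through `Brick.ival`)

Copied from `ArithStatLadderIqThreeNotPPolyStubSamplerFP.lean` (the helpers are `private` there). -/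

/-- A numeral-valued brick `p ∈ FP` lifts to an integer code of value `⟦p z⟧` (pair it with `ε`).
(copied from ArithStatLadderIqThreeNotPPolyStubSamplerFP.lean) -/
private theorem exists_ival_nat {p : List Bool → List Bool} (hp : p ∈ FP) :
    ∃ m ∈ FP, ∀ z, ival (m z) = (bitsToNat (p z) : ℤ) :=
  ⟨fanoutFn p (fun _ => []), fanoutFn_mem_FP hp (const_mem_FP _), fun z => by simp⟩

/-- Integer constants are `FP` expressions.
(copied from ArithStatLadderIqThreeNotPPolyStubSamplerFP.lean) -/
private theorem exists_ival_const (c : ℤ) : ∃ m ∈ FP, ∀ z, ival (m z) = c :=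
  ⟨fun _ => dpEnc c, const_mem_FP _, fun _ => ival_dpEnc c⟩

/-- Products of `FP` expressions (`zmulF`).
(copied from ArithStatLadderIqThreeNotPPolyStubSamplerFP.lean) -/
private theorem exists_ival_mul {φ ψ : List Bool → ℤ}
    (hφ : ∃ m ∈ FP, ∀ z, ival (m z) = φ z) (hψ : ∃ m ∈ FP, ∀ z, ival (m z) = ψ z) :
    ∃ m ∈ FP, ∀ z, ival (m z) = φ z * ψ z := by
  obtain ⟨p, hp, hpv⟩ := hφ
  obtain ⟨q, hq, hqv⟩ := hψ
  exact ⟨zmulF ∘ fanoutFn p q, comp_mem_FP zmulF_mem_FP (fanoutFn_mem_FP hp hq), fun z => by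
    rw [Function.comp_apply, fanoutFn_apply, zmulF_boolPair, ival_dpEnc, hpv, hqv]⟩

/-- Sums of `FP` expressions (`zaddF`).
(copied from ArithStatLadderIqThreeNotPPolyStubSamplerFP.lean) -/
private theorem exists_ival_add {φ ψ : List Bool → ℤ}
    (hφ : ∃ m ∈ FP, ∀ z, ival (m z) = φ z) (hψ : ∃ m ∈ FP, ∀ z, ival (m z) = ψ z) :
    ∃ m ∈ FP, ∀ z, ival (m z) = φ z + ψ z := by
  obtain ⟨p, hp, hpv⟩ := hφ
  obtain ⟨q, hq, hqv⟩ := hψ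
  exact ⟨zaddF ∘ fanoutFn p q, comp_mem_FP zaddF_mem_FP (fanoutFn_mem_FP hp hq), fun z => by
    rw [Function.comp_apply, fanoutFn_apply, zaddF_boolPair, ival_dpEnc, hpv, hqv]⟩

/-- Differences of `FP` expressions (`zsubF`).
(copied from ArithStatLadderIqThreeNotPPolyStubSamplerFP.lean) -/
private theorem exists_ival_sub {φ ψ : List Bool → ℤ}
    (hφ : ∃ m ∈ FP, ∀ z, ival (m z) = φ z) (hψ : ∃ m ∈ FP, ∀ z, ival (m z) = ψ z) :
    ∃ m ∈ FP, ∀ z, ival (m z) = φ z - ψ z := by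
  obtain ⟨p, hp, hpv⟩ := hφ
  obtain ⟨q, hq, hqv⟩ := hψ
  exact ⟨zsubF ∘ fanoutFn p q, comp_mem_FP zsubF_mem_FP (fanoutFn_mem_FP hp hq), fun z => by
    rw [Function.comp_apply, fanoutFn_apply, zsubF_boolPair, ival_dpEnc, hpv, hqv]⟩

/-- Canonical output of an `FP` expression (`zcanonF`): the code `dpEnc` of its value.
(copied from ArithStatLadderIqThreeNotPPolyStubSamplerFP.lean) -/
private theorem exists_canon {φ : List Bool → ℤ} (hφ : ∃ m ∈ FP, ∀ z, ival (m z) = φ z) :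
    ∃ m ∈ FP, ∀ z, m z = dpEnc (φ z) := by
  obtain ⟨p, hp, hpv⟩ := hφ
  exact ⟨zcanonF ∘ p, comp_mem_FP zcanonF_mem_FP hp, fun z => by
    rw [Function.comp_apply, zcanonF_eq, hpv]⟩

/-- The absolute value of a canonical code as a numeral: `addFn (dpEnc z) = bin |z|`.
(copied from ArithStatLadderIqThreeNotPPolyStubSamplerFP.lean) -/
private theorem addFn_dpEnc (z : ℤ) : addFn (dpEnc z) = encodeNat z.natAbs := by
  rw [dpEnc_eq, addFn_boolPair, bitsToNat_cP_add_cQ]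

/-! ### The arithmetic stage: the integer closed form on `⟨x, r⟩` -/

/-- On pairs `⟨x, r⟩` an `FP` function outputs the canonical code of the integer
`N · t · (27 · N · t − 4)`, `N = ⟦x⟧`, `t = 1 + 2 · N · ⟦r⟧`. -/
private theorem exists_arithAP : ∃ h ∈ FP, ∀ x r : List Bool,
    h (boolPair x r) = dpEnc ((bitsToNat x : ℤ) * (1 + 2 * bitsToNat x * bitsToNat r) *
      (27 * bitsToNat x * (1 + 2 * bitsToNat x * bitsToNat r) - 4)) := by
  have hN : ∃ m ∈ FP, ∀ z, ival (m z) = (bitsToNat (fstF z) : ℤ) := exists_ival_nat fstF_mem_FP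
  have hK : ∃ m ∈ FP, ∀ z, ival (m z) = (bitsToNat (sndF z) : ℤ) := exists_ival_nat sndF_mem_FP
  -- `t = 1 + 2 N k`
  have hT := exists_ival_add (exists_ival_const 1) (exists_ival_mul (exists_ival_mul (exists_ival_const 2) hN) hK)
  -- `N t (27 N t - 4)`
  have hD := exists_ival_mul (exists_ival_mul hN hT)
    (exists_ival_sub (exists_ival_mul (exists_ival_mul (exists_ival_const 27) hN) hT) (exists_ival_const 4))
  obtain ⟨h, hh, hhv⟩ := exists_canon hD
  refine ⟨h, hh, fun x r => ?_⟩
  rw [hhv, fstF_boolPair, sndF_boolPair]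

/-- The integer closed form agrees with the truncated natural one: for `N ≥ 1` the subtrahend `4`
is at most `27 ≤ 27 N t`, and for `N = 0` both sides vanish. -/
private theorem natAbs_closedForm (N k : ℕ) :
    Int.natAbs ((N : ℤ) * (1 + 2 * N * k) * (27 * N * (1 + 2 * N * k) - 4)) =
      N * (1 + 2 * N * k) * (27 * N * (1 + 2 * N * k) - 4) := by
  have key : ∀ P : ℕ, Int.natAbs ((P : ℤ) * (27 * P - 4)) = P * (27 * P - 4) := by
    intro P
    rcases Nat.eq_zero_or_pos P with rfl | hP
    · simp
    · have h : (27 * (P : ℤ) - 4) = ((27 * P - 4 : ℕ) : ℤ) := by omega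
      rw [h, ← Nat.cast_mul, Int.natAbs_natCast]
  have e1 : (N : ℤ) * (1 + 2 * N * k) * (27 * N * (1 + 2 * N * k) - 4) =
      ((N * (1 + 2 * N * k) : ℕ) : ℤ) * (27 * ((N * (1 + 2 * N * k) : ℕ) : ℤ) - 4) := by
    push_cast; ring
  rw [e1, key, mul_assoc 27 N]

/-! ### The registered stub -/

/-- **STUB · `stub_samplerAP`.** The sampler of the one-parameter planted family — on `⟨x, r⟩`, with
`N = ⟦x⟧`, `k = ⟦r⟧`, `t = 1 + 2 N k`, output the canonical numeral of `N t (27 N t − 4)` (the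
absolute discriminant of `X³ − X² Y + N t Y³`) — is a polynomial-time string function:
`addFn ∘ arith` with the integer stage `exists_arithAP`, the absolute value `addFn_dpEnc`, and the
comparison of closed forms `natAbs_closedForm`. -/
theorem stub_samplerAP :
    ∃ f : List Bool → List Bool, f ∈ FP ∧ ∀ x r : List Bool,
      f (boolPair x r) = encodeNat (bitsToNat x * (1 + 2 * bitsToNat x * bitsToNat r) *
        (27 * bitsToNat x * (1 + 2 * bitsToNat x * bitsToNat r) - 4)) := by
  obtain ⟨h, hh, hhv⟩ := exists_arithAP
  refine ⟨addFn ∘ h, comp_mem_FP addFn_mem_FP hh, fun x r => ?_⟩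
  rw [Function.comp_apply, hhv, addFn_dpEnc, natAbs_closedForm]

end Summit.QuantumAdvantage.QuantumAdvantage.Theorems.IqThreeNotPPoly

end
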